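import Mathlib
import Summits.Ventures.HodgeRepro2.Tier7.Line1.SepModule

/-!
# Tier7/Line1/SepModuleIrred — the stable subspaces of `M = Fin 2 → U` are `⊥, P_A, P_B, ⊤`

The SEPARATING DATUM of t7-L1-p2 (LINE L1, residual probe), module-theoretic half, part 2. The pieces
`PW 0 = W⁰ ⊗ ℂ²` and `PW sq = Wˢ ⊗ ℂ²` are IRREDUCIBLE under the generators (`eq_PW_of_stable`: the index sign
isolates a coordinate, the simplicity `Wmod_eq_of_stable` of `SepWeightSimple` fills the coordinate, the swap fills
the other), and with the Fix-relation argument of `SepModule` every stable subspace is one of `⊥`, `PW 0`, `PW sq`,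
`⊤` (`stableM_cases`) — this is (H9) semisimplicity and, with `hom_zero_to_sq` / `hom_sq_to_zero`, (H10)
multiplicity one for the datum. Author: t7-L1-p2 (prover-pub-hodge-repro2-t7-L1-p2-g0-0). §8(d): NO.
-/

namespace Summit.Ventures.HodgeRepro2.Tier7.Line1.Sep

open Finset

noncomputable section

/-! ## The generators on the coordinate vectors -/

/-- the flips act on a coordinate vector -/
theorem flipM_single (n : ℕ) (k : Fin 2) (w : U) : flipM n (Pi.single k w) = Pi.single k (flipU n w) := by
  funext j
  by_cases h : j = k
  · subst h; simp
  · simp [h]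

/-- the signs act on a coordinate vector -/
theorem sgnM_single (n : ℕ) (k : Fin 2) (w : U) : sgnM n (Pi.single k w) = Pi.single k (sgnU n w) := by
  funext j
  by_cases h : j = k
  · subst h; simp
  · simp [h]

/-- the swap moves a coordinate vector -/
theorem swapM_single (k : Fin 2) (w : U) : swapM (Pi.single k w) = Pi.single (Equiv.swap 0 1 k) w := by
  funext j
  simp only [swapM_apply, Pi.single_apply, Equiv.swap_apply_eq_iff]

/-- every element is the sum of its two coordinate vectors -/
theorem eq_single_add_single (x : M) : x = Pi.single 0 (x 0) + Pi.single 1 (x 1) := by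
  funext j
  fin_cases j <;> simp

/-- the index sign isolates the `0`-coordinate: `(1/2)(x + signM x) = (x 0, 0)` -/
theorem single_zero_eq (x : M) : Pi.single 0 (x 0) = (1 / 2 : ℂ) • (x + signM x) := by
  funext j
  apply Subtype.ext
  funext ω
  fin_cases j
  · simp; ring
  · simp [signK]

/-- a stable subspace contains the `0`-coordinate vector of each of its elements -/
theorem StableM.single_zero_mem {X : Submodule ℂ M} (hX : StableM X) {x : M} (hx : x ∈ X) :
    Pi.single 0 (x 0) ∈ X := by
  rw [single_zero_eq]
  exact X.smul_mem _ (X.add_mem hx (hX.sign_mem x hx))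

/-- stability passes to intersections -/
theorem StableM.inf {X Y : Submodule ℂ M} (hX : StableM X) (hY : StableM Y) : StableM (X ⊓ Y) where
  flip_mem n x hx := ⟨hX.flip_mem n x hx.1, hY.flip_mem n x hx.2⟩
  sgn_mem n x hx := ⟨hX.sgn_mem n x hx.1, hY.sgn_mem n x hx.2⟩
  swap_mem x hx := ⟨hX.swap_mem x hx.1, hY.swap_mem x hx.2⟩
  sign_mem x hx := ⟨hX.sign_mem x hx.1, hY.sign_mem x hx.2⟩

/-! ## Irreducibility of the pieces -/

/-- the `U`-vectors `w` with `(w, 0) ∈ X`, as functions on `Ω` -/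
def coord0 (X : Submodule ℂ M) : Submodule ℂ (Ω → ℂ) where
  carrier := {f | ∃ w : U, (w : Ω → ℂ) = f ∧ Pi.single 0 w ∈ X}
  zero_mem' := ⟨0, rfl, by simp⟩
  add_mem' := by
    rintro f g ⟨w, rfl, hw⟩ ⟨w', rfl, hw'⟩
    exact ⟨w + w', rfl, by rw [Pi.single_add]; exact X.add_mem hw hw'⟩
  smul_mem' := by
    rintro c f ⟨w, rfl, hw⟩
    exact ⟨c • w, rfl, by rw [Pi.single_smul]; exact X.smul_mem c hw⟩

/-- membership in `coord0` -/
theorem mem_coord0 {X : Submodule ℂ M} {f : Ω → ℂ} :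
    f ∈ coord0 X ↔ ∃ w : U, (w : Ω → ℂ) = f ∧ Pi.single 0 w ∈ X := Iff.rfl

/-- `coord0` of a stable subspace is stable under the flips and signs -/
theorem stable_coord0 {X : Submodule ℂ M} (hX : StableM X) : Stable (coord0 X) where
  flip_mem n f hf := by
    obtain ⟨w, rfl, hw⟩ := hf
    exact ⟨flipU n w, rfl, by rw [← flipM_single]; exact hX.flip_mem n _ hw⟩
  sgn_mem n f hf := by
    obtain ⟨w, rfl, hw⟩ := hf
    exact ⟨sgnU n w, rfl, by rw [← sgnM_single]; exact hX.sgn_mem n _ hw⟩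

/-- `coord0` of a subspace of `PW s` lies in `Wmod s` -/
theorem coord0_le {s : ℕ → ℂ} {X : Submodule ℂ M} (hle : X ≤ PW s) : coord0 X ≤ Wmod s := by
  rintro f ⟨w, rfl, hw⟩
  simpa using mem_PW.1 (hle hw) 0

/-- IRREDUCIBILITY: a non-zero stable subspace of a piece is the piece -/
theorem eq_PW_of_stable {s : ℕ → ℂ} {X : Submodule ℂ M} (hX : StableM X) (hle : X ≤ PW s)
    (hne : X ≠ ⊥) : X = PW s := by
  have key : ∀ x ∈ X, x 0 ≠ 0 → X = PW s := by
    intro x hx hx0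
    have hQ : coord0 X = Wmod s := by
      refine Wmod_eq_of_stable (stable_coord0 hX) (coord0_le hle) fun hbot => hx0 ?_
      have hmem : ((x 0 : U) : Ω → ℂ) ∈ coord0 X := ⟨x 0, rfl, hX.single_zero_mem hx⟩
      rw [hbot, Submodule.mem_bot] at hmem
      exact Subtype.ext hmem
    refine le_antisymm hle fun y hy => ?_
    have h0 : Pi.single 0 (y 0) ∈ X := by
      have : ((y 0 : U) : Ω → ℂ) ∈ coord0 X := by rw [hQ]; exact mem_PW.1 hy 0
      obtain ⟨w, hw, hwX⟩ := this
      rwa [Subtype.ext hw] at hwX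
    have h1 : Pi.single 1 (y 1) ∈ X := by
      have : ((y 1 : U) : Ω → ℂ) ∈ coord0 X := by rw [hQ]; exact mem_PW.1 hy 1
      obtain ⟨w, hw, hwX⟩ := this
      have := hX.swap_mem _ hwX
      rw [swapM_single, Subtype.ext hw] at this
      simpa using this
    rw [eq_single_add_single y]
    exact X.add_mem h0 h1
  obtain ⟨x, hx, hx0⟩ := (Submodule.ne_bot_iff X).1 hne
  by_cases h : x 0 = 0
  · have h1 : x 1 ≠ 0 := fun h1 => hx0 (by funext j; fin_cases j <;> simp [h, h1])
    exact key (swapM x) (hX.swap_mem x hx) (by simpa using h1)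
  · exact key x hx h

/-! ## The classification -/

/-- a stable subspace meeting `PW sq` in `⊥` and `PW 0` in `PW 0` is `PW 0` -/
theorem eq_PW_zero_of_inf {X : Submodule ℂ M} (hA : PW 0 ≤ X) (hB : X ⊓ PW sq = ⊥) : X = PW 0 := by
  refine le_antisymm (fun x hx => ?_) hA
  have hx' : x ∈ PW 0 ⊔ PW sq := by rw [PW_zero_sup_PW_sq]; exact Submodule.mem_top
  obtain ⟨a, ha, b, hb, rfl⟩ := Submodule.mem_sup.1 hx'
  have hbX : b ∈ X := by
    have := X.sub_mem hx (hA ha)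
    rwa [add_sub_cancel_left] at this
  have hb0 : b = 0 := by
    have : b ∈ X ⊓ PW sq := ⟨hbX, hb⟩
    rwa [hB, Submodule.mem_bot] at this
  rw [hb0, add_zero]
  exact ha

/-- a stable subspace meeting `PW 0` in `⊥` and `PW sq` in `PW sq` is `PW sq` -/
theorem eq_PW_sq_of_inf {X : Submodule ℂ M} (hA : X ⊓ PW 0 = ⊥) (hB : PW sq ≤ X) : X = PW sq := by
  refine le_antisymm (fun x hx => ?_) hB
  have hx' : x ∈ PW 0 ⊔ PW sq := by rw [PW_zero_sup_PW_sq]; exact Submodule.mem_top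
  obtain ⟨a, ha, b, hb, rfl⟩ := Submodule.mem_sup.1 hx'
  have haX : a ∈ X := by
    have := X.sub_mem hx (hB hb)
    rwa [add_sub_cancel_right] at this
  have ha0 : a = 0 := by
    have : a ∈ X ⊓ PW 0 := ⟨haX, ha⟩
    rwa [hA, Submodule.mem_bot] at this
  rw [ha0, zero_add]
  exact hb

/-- THE CLASSIFICATION: a stable subspace of `M` is `⊥`, `PW 0`, `PW sq` or `⊤` -/
theorem stableM_cases {X : Submodule ℂ M} (hX : StableM X) :
    X = ⊥ ∨ X = PW 0 ∨ X = PW sq ∨ X = ⊤ := by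
  have hA : StableM (X ⊓ PW 0) := hX.inf (stableM_PW 0)
  have hB : StableM (X ⊓ PW sq) := hX.inf (stableM_PW sq)
  rcases eq_or_ne (X ⊓ PW 0) ⊥ with hA0 | hA0 <;> rcases eq_or_ne (X ⊓ PW sq) ⊥ with hB0 | hB0
  · exact Or.inl (eq_bot_of_inf_eq_bot hX hA0 hB0)
  · have hBeq : X ⊓ PW sq = PW sq := eq_PW_of_stable hB inf_le_right hB0
    exact Or.inr (Or.inr (Or.inl (eq_PW_sq_of_inf hA0 (hBeq ▸ inf_le_left))))
  · have hAeq : X ⊓ PW 0 = PW 0 := eq_PW_of_stable hA inf_le_right hA0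
    exact Or.inr (Or.inl (eq_PW_zero_of_inf (hAeq ▸ inf_le_left) hB0))
  · have hAeq : X ⊓ PW 0 = PW 0 := eq_PW_of_stable hA inf_le_right hA0
    have hBeq : X ⊓ PW sq = PW sq := eq_PW_of_stable hB inf_le_right hB0
    refine Or.inr (Or.inr (Or.inr ?_))
    rw [eq_top_iff, ← PW_zero_sup_PW_sq]
    exact sup_le (hAeq ▸ inf_le_left) (hBeq ▸ inf_le_left)

/-- the pieces are non-zero -/
theorem PW_ne_bot (s : ℕ → ℂ) (hs : Wmod s ≤ Usub) : PW s ≠ ⊥ := by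
  intro h
  have hmem : Pi.single (0 : Fin 2) (⟨wt s, hs (level_le_Wmod s ∅ (wt_mem_level s))⟩ : U) ∈ PW s :=
    mem_PW.2 fun k => by
      by_cases hk : k = 0
      · subst hk; simpa using level_le_Wmod s ∅ (wt_mem_level s)
      · simp [hk]
  rw [h, Submodule.mem_bot] at hmem
  have := congrArg (fun x : M => (x 0 : Ω → ℂ)) hmem
  simp only [Pi.single_eq_same, Pi.zero_apply, Submodule.coe_zero] at this
  exact wt_ne_zero s this

/-- `PW 0 ≠ PW sq` -/
theorem PW_zero_ne_PW_sq : PW 0 ≠ PW sq := by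
  intro h
  have := PW_zero_inf_PW_sq
  rw [← h, inf_idem] at this
  exact PW_ne_bot 0 Wmod_zero_le_Usub this

/-- `PW 0 ≠ ⊤` -/
theorem PW_zero_ne_top : PW 0 ≠ ⊤ := by
  intro h
  have := PW_zero_inf_PW_sq
  rw [h, top_inf_eq] at this
  exact PW_ne_bot sq Wmod_sq_le_Usub this

/-- `PW sq ≠ ⊤` -/
theorem PW_sq_ne_top : PW sq ≠ ⊤ := by
  intro h
  have := PW_zero_inf_PW_sq
  rw [h, inf_top_eq] at this
  exact PW_ne_bot 0 Wmod_zero_le_Usub this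

end

end Summit.Ventures.HodgeRepro2.Tier7.Line1.Sep
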